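import Summits.CriticalPhenomena.PercolationContinuityZ3.Theorems.PercNearOneGluingNoHeavyLowerTailSahiGridPatternCoOrthant

/-!
# `NoHeavyLowerTail` (crux stmt-CriticalPhenomena-4575), Sahi programme: **THE PATTERN INEQUALITY WITH ONE NESTED-CANALYSING SLOT,
# EVERY DIMENSION** (the closure of the five one-coordinate lifts)

Support file (seat `prim-sahi-p1`, generation 9; `--supports stmt-CriticalPhenomena-4575`).  One definition (`canalLift`), one inductive
predicate (`IsCanalysing`), proofs; no `sorry`, standard axioms.

A subset `A ⊆ [3]^d` is NESTED CANALYSING (a monotone read-once decision list in the coordinates) if it is `[3]^d`, `∅`, an axis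
permutation of a nested-canalysing set, or a ONE-COORDINATE DECISION over a nested-canalysing inner set `D ⊆ [3]^n`:
`canalLift D t s = {x ∈ [3]^{n+1} : x_last ≥ s, or (x_last ≥ t and init x ∈ D)}` with thresholds `t ≤ s`... (any `t, s : ℕ`; the pure
cylinder `t = 0, s ≥ 3`, i.e. `D × [3]`, is excluded).  Examples: every orthant `{x ≥ p}` (all decisions of AND type), every co-orthant
`{x : ∃ a, x_a > q_a}` (all of OR type), `{x₁ ≥ 1} ∪ ({x₂ ≥ 2} ∩ {x₃ ≥ 1})`, … ; on the Boolean cube these are the monotone nested-canalysing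
(unate cascade) functions `x_{a₁} ∘₁ (x_{a₂} ∘₂ (⋯))`, `∘_i ∈ {∧, ∨}`.

THEOREM (`sStarD_nonneg_of_isCanalysing`, every `d`): if `A` is nested canalysing then `sStarD A B C ≥ 0` for ALL up-sets `B, C ⊆ [3]^d`
— the pattern inequality `PatternPos d` restricted to one nested-canalysing slot, hence (by `latticeE3_symm`) Sahi's `C₃` / Kahn's
Conjecture 5 at `n = 3`, coefficientwise, for every product weight on every `d`-dimensional grid when one of the three increasing events is
nested canalysing in the coordinate thresholds.  Proof: induction on the derivation, using the five lifts — top-only `(∅,∅,D)`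
(`two_mul_sStarD_top_le_of_topOnly`, prim-ineq-gen-4 g11), two-level `(∅,D,D)` (`sum_sStarD_le_of_liftTwo`), co-top `(D,⊤,⊤)`
(`sStarD_nonneg_of_coTop`), co-mid `(D,D,⊤)` (`sum_sStarD_le_of_coMid`), mid-top `(∅,D,⊤)` (`sum_sStarD_le_of_midTop`) — and the axis
symmetry `slicePos_perm`.  The cylinder `(D,D,D)` has no instance-blind lift (seat memo, kit j130128), which is why it is excluded. [this work]
-/

namespace Summit.CriticalPhenomena.PercolationContinuityZ3.Theorems.SahiGridPattern

open Finset SahiGrid3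
open scoped BigOperators

variable {n : ℕ}

/-- **One-coordinate decision** over the inner set `D ⊆ [3]^n` with thresholds `t, s`: the subset of `[3]^{n+1}` of points `x` with
`x_last ≥ s`, or `x_last ≥ t` and `init x ∈ D`.  Its slices along the last axis are `⊤` (levels `≥ s`), `D` (levels in `[t,s)`), `∅`
(levels `< t`). [this work] -/
def canalLift (D : Finset (Pd n)) (t s : ℕ) : Finset (Pd (n + 1)) :=
  univ.filter fun x : Pd (n + 1) => s ≤ ((x (Fin.last n) : Fin 3) : ℕ) ∨ (t ≤ ((x (Fin.last n) : Fin 3) : ℕ) ∧ (fun b => x (Fin.castSucc b)) ∈ D)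

/-- **Nested-canalysing subsets of `[3]^d`** (monotone read-once decision lists): generated from `[3]^d` and `∅` by one-coordinate
decisions `canalLift D t s` other than the pure cylinder (`t = 0 ∧ s ≥ 3`) and by axis permutations; in addition the 'OR-top' decision
`canalLift D 0 1 = {x : x_last ≥ 1} ∪ D×{0}` over an ARBITRARY up-set `D` (constructor `orTop`: by the unconditional co-top lift such a
set is a good slot whatever `D` is). [this work] -/
inductive IsCanalysing : ∀ {d : ℕ}, Finset (Pd d) → Prop
  | univ (d : ℕ) : IsCanalysing (Finset.univ : Finset (Pd d))
  | empty (d : ℕ) : IsCanalysing (∅ : Finset (Pd d))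
  | lift {n : ℕ} {D : Finset (Pd n)} (t s : ℕ) (hts : 0 < t ∨ s ≤ 2) (h : IsCanalysing D) : IsCanalysing (canalLift D t s)
  | orTop {n : ℕ} {D : Finset (Pd n)} (hD : IsUpperSet (D : Set (Pd n))) : IsCanalysing (canalLift D 0 1)
  | perm {d : ℕ} {A : Finset (Pd d)} (τ : Equiv.Perm (Fin d)) (h : IsCanalysing A) :
      IsCanalysing (A.map (compEquivD τ).toEmbedding)

/-- Membership of a `snoc` point in a one-coordinate decision. [this work] -/
theorem snoc_mem_canalLift (D : Finset (Pd n)) (t s : ℕ) (x : Pd n) (l : Fin 3) :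
    (Fin.snoc x l : Pd (n + 1)) ∈ canalLift D t s ↔ (s ≤ (l : ℕ) ∨ (t ≤ (l : ℕ) ∧ x ∈ D)) := by
  unfold canalLift
  rw [Finset.mem_filter]
  simp [Fin.snoc_last, Fin.snoc_castSucc]

/-- A one-coordinate decision over an up-set is an up-set. [this work] -/
theorem isUpperSet_canalLift {D : Finset (Pd n)} (hD : IsUpperSet (D : Set (Pd n))) (t s : ℕ) :
    IsUpperSet ((canalLift D t s : Finset (Pd (n + 1))) : Set (Pd (n + 1))) := by
  intro x y hxy hx
  rw [Finset.mem_coe] at hx ⊢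
  unfold canalLift at hx ⊢
  rw [Finset.mem_filter] at hx ⊢
  have hl : ((x (Fin.last n) : Fin 3) : ℕ) ≤ ((y (Fin.last n) : Fin 3) : ℕ) := by exact_mod_cast hxy (Fin.last n)
  refine ⟨Finset.mem_univ _, ?_⟩
  rcases hx.2 with h | ⟨h1, h2⟩
  · left; exact le_trans h hl
  · right
    refine ⟨le_trans h1 hl, ?_⟩
    have hmono : (fun b => x (Fin.castSucc b)) ≤ fun b => y (Fin.castSucc b) := fun b => hxy (Fin.castSucc b)
    exact hD hmono h2

/-- The empty first slot is (trivially) good. [this work] -/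
theorem sStarD_empty_good {d : ℕ} : ∀ U V : Finset (Pd d), IsUpperSet (U : Set (Pd d)) → IsUpperSet (V : Set (Pd d)) →
    0 ≤ sStarD (∅ : Finset (Pd d)) U V := fun U V _ _ => by rw [sStarD_empty_left]

/-- The lift step: a one-coordinate decision over a good up-set is good (every admissible threshold pair). [this work] -/
theorem sStarD_canalLift_nonneg {D : Finset (Pd n)} (hDup : IsUpperSet (D : Set (Pd n)))
    (hD : ∀ U V : Finset (Pd n), IsUpperSet (U : Set (Pd n)) → IsUpperSet (V : Set (Pd n)) → 0 ≤ sStarD D U V)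
    (t s : ℕ) (hts : 0 < t ∨ s ≤ 2) (B C : Finset (Pd (n + 1)))
    (hB : IsUpperSet (B : Set (Pd (n + 1)))) (hC : IsUpperSet (C : Set (Pd (n + 1)))) :
    0 ≤ sStarD (canalLift D t s) B C := by
  set A := canalLift D t s with hAdef
  have hA : IsUpperSet (A : Set (Pd (n + 1))) := isUpperSet_canalLift hDup t s
  have mem : ∀ (x : Pd n) (l : Fin 3), (Fin.snoc x l : Pd (n + 1)) ∈ A ↔ (s ≤ (l : ℕ) ∨ (t ≤ (l : ℕ) ∧ x ∈ D)) :=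
    fun x l => snoc_mem_canalLift D t s x l
  have v0 : (((0 : Fin 3)) : ℕ) = 0 := rfl
  have v1 : (((1 : Fin 3)) : ℕ) = 1 := rfl
  have v2 : (((2 : Fin 3)) : ℕ) = 2 := rfl
  -- goodness of the possible slices
  have hB0 := isUpperSet_filter_snoc hB 0
  have hB1 := isUpperSet_filter_snoc hB 1
  have hB2 := isUpperSet_filter_snoc hB 2
  have hC0 := isUpperSet_filter_snoc hC 0
  have hC1 := isUpperSet_filter_snoc hC 1
  have hC2 := isUpperSet_filter_snoc hC 2
  rcases (by omega : s = 0 ∨ s = 1 ∨ s = 2 ∨ 3 ≤ s) with hs | hs | hs | hs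
  · -- s = 0: A = ⊤
    have e : A = univ := by
      ext x; simp only [Finset.mem_univ, iff_true]
      have hx : x = Fin.snoc (fun b => x (Fin.castSucc b)) (x (Fin.last n)) := (Fin.snoc_init_self x).symm
      rw [hx, mem]; left; omega
    rw [e]; exact sStarD_nonneg_of_eq_univ₁ hB hC
  · -- s = 1: pattern (·,⊤,⊤): co-top lift, unconditional
    have hA1 : ∀ x : Pd n, (Fin.snoc x 1 : Pd (n + 1)) ∈ A := fun x => by rw [mem, v1]; left; omega
    exact sStarD_nonneg_of_coTop A B C hA hB hC hA1
  · -- s = 2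
    have hA2 : ∀ x : Pd n, (Fin.snoc x 2 : Pd (n + 1)) ∈ A := fun x => by rw [mem, v2]; left; omega
    rcases Nat.eq_zero_or_pos t with ht | ht
    · -- t = 0: pattern (D,D,⊤): co-mid lift
      have hA0 : ∀ x : Pd n, (Fin.snoc x 0 : Pd (n + 1)) ∈ A ↔ x ∈ D := fun x => by
        rw [mem, v0, hs, ht]; constructor
        · rintro (h | ⟨_, h⟩)
          · exfalso; omega
          · exact h
        · intro h; right; exact ⟨le_refl _, h⟩
      have hA1 : ∀ x : Pd n, (Fin.snoc x 1 : Pd (n + 1)) ∈ A ↔ x ∈ D := fun x => by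
        rw [mem, v1, hs, ht]; constructor
        · rintro (h | ⟨_, h⟩)
          · exfalso; omega
          · exact h
        · intro h; right; exact ⟨by omega, h⟩
      exact sStarD_nonneg_coMid_of_good hD A B C hA hB hC hA0 hA1 hA2
    · -- t ≥ 1: pattern (∅,D',⊤) with D' ∈ {D, ∅}: mid-top lift
      have hA0 : ∀ x : Pd n, (Fin.snoc x 0 : Pd (n + 1)) ∉ A := fun x => by
        rw [mem, v0]; rintro (h | ⟨h, _⟩) <;> omega
      have L := sum_sStarD_le_of_midTop A B C hA hB hC hA0 hA2
      by_cases ht1 : t = 1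
      · have e : (univ.filter fun q : Pd n => (Fin.snoc q 1 : Pd (n + 1)) ∈ A) = D := by
          ext q; simp only [Finset.mem_filter, Finset.mem_univ, true_and, mem, v1]
          constructor
          · rintro (h | ⟨_, h⟩)
            · exfalso; omega
            · exact h
          · intro h; right; exact ⟨by omega, h⟩
        rw [e] at L
        have h12 := hD _ _ hB1 hC2
        have h21 := hD _ _ hB2 hC1
        linarith
      · have e : (univ.filter fun q : Pd n => (Fin.snoc q 1 : Pd (n + 1)) ∈ A) = ∅ := by
          ext q; simp only [Finset.mem_filter, Finset.mem_univ, true_and, mem, v1, Finset.notMem_empty, iff_false]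
          rintro (h | ⟨h, _⟩) <;> omega
        rw [e, sStarD_empty_left, sStarD_empty_left] at L
        linarith
  · -- s ≥ 3: the top slice is not full
    rcases (by omega : t = 0 ∨ t = 1 ∨ 2 ≤ t) with ht | ht | ht
    · -- cylinder: excluded
      exfalso; omega
    · -- t = 1: pattern (∅,D,D): two-level lift
      have hA0 : ∀ x : Pd n, (Fin.snoc x 0 : Pd (n + 1)) ∉ A := fun x => by
        rw [mem, v0]; rintro (h | ⟨h, _⟩) <;> omega
      have hA1 : ∀ x : Pd n, (Fin.snoc x 1 : Pd (n + 1)) ∈ A ↔ x ∈ D := fun x => by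
        rw [mem, v1]; constructor
        · rintro (h | ⟨_, h⟩)
          · exfalso; omega
          · exact h
        · intro h; right; exact ⟨by omega, h⟩
      have hA2 : ∀ x : Pd n, (Fin.snoc x 2 : Pd (n + 1)) ∈ A ↔ x ∈ D := fun x => by
        rw [mem, v2]; constructor
        · rintro (h | ⟨_, h⟩)
          · exfalso; omega
          · exact h
        · intro h; right; exact ⟨by omega, h⟩
      exact sStarD_nonneg_liftTwo_of_good hD A B C hA hB hC hA0 hA1 hA2
    · -- t ≥ 2: pattern (∅,∅,D') with D' ∈ {D, ∅}: top-only lift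
      have hA0 : ∀ x : Pd n, (Fin.snoc x 0 : Pd (n + 1)) ∉ A := fun x => by
        rw [mem, v0]; rintro (h | ⟨h, _⟩) <;> omega
      have hA1 : ∀ x : Pd n, (Fin.snoc x 1 : Pd (n + 1)) ∉ A := fun x => by
        rw [mem, v1]; rintro (h | ⟨h, _⟩) <;> omega
      have L := two_mul_sStarD_top_le_of_topOnly A B C hA hB hC hA0 hA1
      by_cases ht2 : t = 2
      · have e : (univ.filter fun q : Pd n => (Fin.snoc q 2 : Pd (n + 1)) ∈ A) = D := by
          ext q; simp only [Finset.mem_filter, Finset.mem_univ, true_and, mem, v2]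
          constructor
          · rintro (h | ⟨_, h⟩)
            · exfalso; omega
            · exact h
          · intro h; right; exact ⟨by omega, h⟩
        rw [e] at L
        have h22 := hD _ _ hB2 hC2
        linarith
      · have e : (univ.filter fun q : Pd n => (Fin.snoc q 2 : Pd (n + 1)) ∈ A) = ∅ := by
          ext q; simp only [Finset.mem_filter, Finset.mem_univ, true_and, mem, v2, Finset.notMem_empty, iff_false]
          rintro (h | ⟨h, _⟩) <;> omega
        rw [e, sStarD_empty_left] at L
        linarith

/-- **THE PATTERN INEQUALITY WITH ONE NESTED-CANALYSING SLOT, EVERY DIMENSION**: a nested-canalysing `A ⊆ [3]^d` is an up-set and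
`0 ≤ sStarD A B C` for all up-sets `B, C ⊆ [3]^d`. [this work] -/
theorem sStarD_nonneg_of_isCanalysing {d : ℕ} {A : Finset (Pd d)} (hA : IsCanalysing A) :
    IsUpperSet (A : Set (Pd d)) ∧
      ∀ B C : Finset (Pd d), IsUpperSet (B : Set (Pd d)) → IsUpperSet (C : Set (Pd d)) → 0 ≤ sStarD A B C := by
  induction hA with
  | univ d =>
    refine ⟨by rw [Finset.coe_univ]; exact isUpperSet_univ, fun B C hB hC => sStarD_nonneg_of_eq_univ₁ hB hC⟩
  | empty d =>
    refine ⟨by rw [Finset.coe_empty]; exact isUpperSet_empty, fun B C _ _ => by rw [sStarD_empty_left]⟩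
  | lift t s hts h ih =>
    exact ⟨isUpperSet_canalLift ih.1 t s, fun B C hB hC => sStarD_canalLift_nonneg ih.1 ih.2 t s hts B C hB hC⟩
  | orTop hD =>
    rename_i n D
    refine ⟨isUpperSet_canalLift hD 0 1, fun B C hB hC => ?_⟩
    have hA1 : ∀ x : Pd n, (Fin.snoc x 1 : Pd (n + 1)) ∈ canalLift D 0 1 := fun x => by
      rw [snoc_mem_canalLift]; left; exact le_of_eq rfl
    exact sStarD_nonneg_of_coTop _ B C (isUpperSet_canalLift hD 0 1) hB hC hA1
  | perm τ h ih =>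
    rename_i d A
    refine ⟨isUpperSet_map_compEquivD τ ih.1, fun B C hB hC => ?_⟩
    have hmem : ∀ p : Pd d, p ∈ A.map (compEquivD τ).toEmbedding ↔ p ∘ τ.symm ∈ A := by
      intro p; rw [Finset.mem_map_equiv]; rfl
    have step : ∀ B' C' : Finset (Pd d), IsUpperSet (B' : Set (Pd d)) → IsUpperSet (C' : Set (Pd d)) →
        0 ≤ ∑ x ∈ A, ∑ y ∈ B', ∑ z ∈ C', tcD x y z := by
      intro B' C' hB' hC'; rw [← sStarD_eq_sum_tcD]; exact ih.2 B' C' hB' hC'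
    rw [sStarD_eq_sum_tcD]
    exact slicePos_perm τ.symm step hmem B C hB hC

/-- Nested-canalysing slot in the second position. [this work] -/
theorem sStarD_nonneg_of_isCanalysing₂ {d : ℕ} {A B C : Finset (Pd d)} (hB : IsCanalysing B)
    (hA : IsUpperSet (A : Set (Pd d))) (hC : IsUpperSet (C : Set (Pd d))) : 0 ≤ sStarD A B C := by
  rw [sStarD_swap12]; exact (sStarD_nonneg_of_isCanalysing hB).2 A C hA hC

/-- Nested-canalysing slot in the third position. [this work] -/
theorem sStarD_nonneg_of_isCanalysing₃ {d : ℕ} {A B C : Finset (Pd d)} (hC : IsCanalysing C)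
    (hA : IsUpperSet (A : Set (Pd d))) (hB : IsUpperSet (B : Set (Pd d))) : 0 ≤ sStarD A B C := by
  rw [sStarD_swap23, sStarD_swap12]; exact (sStarD_nonneg_of_isCanalysing hC).2 A B hA hB

/-- Example: every orthant `{x : p ≤ x}` is nested canalysing... (statement-level examples are the orthant and co-orthant theorems
`sStarD_principal_nonneg`, `sStarD_coprincipal_nonneg` proved directly).  Here: the half-space `{x : x_last ≥ 1} = canalLift ⊤ 1 1`
hmm — we record the simplest mixed example `canalLift (canalLift univ 2 2) 0 1` ('x_last ≥ 1, or x_{last-1} ≥ 2') is canalysing. [this work] -/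
theorem isCanalysing_example : IsCanalysing (canalLift (canalLift (Finset.univ : Finset (Pd n)) 2 2) 0 1) :=
  IsCanalysing.lift 0 1 (Or.inr (by norm_num)) (IsCanalysing.lift 2 2 (Or.inl (by norm_num)) (IsCanalysing.univ n))

end Summit.CriticalPhenomena.PercolationContinuityZ3.Theorems.SahiGridPattern
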